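import Summits.NavierStokesRegularity.NavierStokesRegularity.Theses.WakeRatchet

/-!
# Route `WakeRatchet` — BLOCK RATE BOOKKEEPING: iteration, per-shell ⇒ block, and the block DISSIPATION-SPLIT GLUE
# (helper for ⟨stmt-NavierStokesRegularity-25646⟩ `EternalInviscidRate`; repair census in kernel form, def-free)

Companion of `WakeRatchetRatchetStarvationBlock.lean` (block starvation ⇒ the route's `a = 1` obligation is insensitive to the block
length).  The O-2 repair of the per-shell rate cruxes ⟨25646⟩/⟨25647⟩/⟨25584⟩ (planner ns-idea-1 g10/g11, LINE g11-2 «block ledger»;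
`block_split_glue.lean` b1ef8ba8, evidence on ⟨25646⟩; NOT filed as items) replaces «the tail above `n+1` is `≤ (1+ε₀)^{−a}·M`» by «the
tail above `n+b` is `≤ (1+ε₀)^{−ab}·M` for some block length `b = b(ε₀,R) ≥ 1`».  This file lands, without any `def`, the three pieces of
bookkeeping the repaired split needs:

* `block_iterate` — a block contraction by `(1+ε₀)^{−ab}` over `b` shells iterates: over `j·b` shells the factor is `(1+ε₀)^{−abj}`.
* `blockRate_of_perShell` — the per-shell rate contraction (the inner statement of the route items) gives the block statement for EVERY
  `b ≥ 1` (so the block forms are WEAKENINGS of the items, not costumes); `EternalInviscidRate_blockForm` records this for ⟨25646⟩ by name.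
* `blockRateRatchet_of_split` — **block split glue**: the block inviscid rate ratchet at spread `R` (`IsEternal`, exponent `a₀`, block `b₀`)
  and the block viscous rate ratchet at spread `R` (`IsEternalVisc` with `ν̂ > 0`, exponent `a₁`, block `b₁`) give the block rate ratchet for
  every covariant viscosity `ν̂ ≥ 0` with `a = min a₀ a₁`, `b = b₁·b₀` (case split on `IsEternalVisc.nonneg`, `isEternalVisc_zero_iff`, then
  `block_iterate`) — the block form of the landed glue ⟨25648⟩ `TailRateRatchetOfDissipationSplit`.  Its conclusion is exactly the hypothesis
  of `RatchetStarvationBlock.noSurvivingEternalViscBdd_of_blockRateRatchet`.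
All statements are written out (no new predicates).  HONEST LABEL: bookkeeping; no registered stub is closed; the block statements are NOT route
items; MODEL lattice only (Tao 2016 §4 renormalised cascade); nothing here bears on the Navier–Stokes equations or the summit.
[cite: Tao2016AveragedNS, §4 Lemma 4.1 (4.8)–(4.10), Thm. 4.2 (statement shape), §6.4; elementary]
-/

noncomputable section

set_option linter.dupNamespace false

open Filter Topology
open Literature.Analysis.FluidPDE.TaoCascade

namespace Summit.NavierStokesRegularity.NavierStokesRegularity.Theorems

namespace WakeRatchetBlockRate

variable {m : ℕ} {ε₀ : ℝ} {W : ℤ → ℝ → Em m}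

/-- **Iteration of a block contraction.**  If the tail above `n+b` is `≤ (1+ε₀)^{−ab}·M` whenever the tail above `n` is `≤ M` (every
shell `n`, every `M`), then the tail above `n + j·b` is `≤ (1+ε₀)^{−abj}·M`.  [cite: Tao2016AveragedNS, §4 (scale ratio); elementary induction] -/
theorem block_iterate {a : ℝ} (hε : 0 < ε₀) {b : ℕ}
    (H : ∀ (n : ℤ) (M : ℝ), (∀ σ : ℝ, ∑' k : ℕ, physEnergy ε₀ W (n + k) σ ≤ M) →
      ∀ σ : ℝ, ∑' k : ℕ, physEnergy ε₀ W (n + b + k) σ ≤ (1 + ε₀) ^ (-(a * b)) * M)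
    (n : ℤ) (M : ℝ) (hM : ∀ σ : ℝ, ∑' k : ℕ, physEnergy ε₀ W (n + k) σ ≤ M) :
    ∀ (j : ℕ) (σ : ℝ),
      ∑' k : ℕ, physEnergy ε₀ W (n + (j * b : ℕ) + k) σ ≤ (1 + ε₀) ^ (-(a * b * j)) * M := by
  intro j
  induction j with
  | zero => intro σ; simpa using hM σ
  | succ j ih =>
    intro σ
    have h1ε : 0 < 1 + ε₀ := by linarith
    have step := H (n + (j * b : ℕ)) ((1 + ε₀) ^ (-(a * b * j)) * M) ih σ
    have e : n + ((j * b : ℕ) : ℤ) + (b : ℤ) = n + (((j + 1) * b : ℕ) : ℤ) := by push_cast; ring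
    rw [e] at step
    refine step.trans (le_of_eq ?_)
    rw [← mul_assoc, ← Real.rpow_add h1ε]
    congr 1; congr 1; push_cast; ring

/-- **Per-shell ⇒ block.**  The per-shell rate contraction by `(1+ε₀)^{−a}` (the inner statement of ⟨25646⟩/⟨25647⟩/⟨25584⟩ for one
solution) gives the block contraction by `(1+ε₀)^{−ab}` over every block length `b`.
[cite: Tao2016AveragedNS, §4 (scale ratio); elementary induction] -/
theorem blockRate_of_perShell {a : ℝ} (hε : 0 < ε₀)
    (H : ∀ (n : ℤ) (M : ℝ), (∀ σ : ℝ, ∑' k : ℕ, physEnergy ε₀ W (n + k) σ ≤ M) →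
      ∀ σ : ℝ, ∑' k : ℕ, physEnergy ε₀ W (n + 1 + k) σ ≤ (1 + ε₀) ^ (-a) * M)
    (b : ℕ) (n : ℤ) (M : ℝ) (hM : ∀ σ : ℝ, ∑' k : ℕ, physEnergy ε₀ W (n + k) σ ≤ M) (σ : ℝ) :
    ∑' k : ℕ, physEnergy ε₀ W (n + b + k) σ ≤ (1 + ε₀) ^ (-(a * b)) * M := by
  have H1 : ∀ (n : ℤ) (M : ℝ), (∀ σ : ℝ, ∑' k : ℕ, physEnergy ε₀ W (n + k) σ ≤ M) →
      ∀ σ : ℝ, ∑' k : ℕ, physEnergy ε₀ W (n + (1 : ℕ) + k) σ ≤ (1 + ε₀) ^ (-(a * (1 : ℕ))) * M := by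
    intro n' M' hM' σ'
    simpa using H n' M' hM' σ'
  have h := block_iterate hε H1 n M hM b σ
  simpa using h

/-- **⟨25646⟩ implies its block form for every block length** (the block repair is a weakening of the item, by name).  MODEL lattice only.
[cite: Tao2016AveragedNS, §4 Thm. 4.2 (statement shape), §6.4; elementary] -/
theorem EternalInviscidRate_blockForm
    (hK : Summit.NavierStokesRegularity.NavierStokesRegularity.Theses.WakeRatchet.EternalInviscidRate)
    {R : ℝ} (hR : 1 ≤ R) :
    ∃ a : ℝ, 1 < a ∧ ∃ εs : ℝ, 0 < εs ∧ ∀ ε₀ : ℝ, 0 < ε₀ → ε₀ ≤ εs →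
      ∀ b : ℕ, 1 ≤ b →
      ∀ α : Fin 4 → Fin 4 → Fin 4 → ℤ × ℤ × ℤ → ℝ, InTableClass R α →
      ∀ W : ℤ → ℝ → Em 4, IsEternal ε₀ α W → UniformBound W →
      ∀ (n : ℤ) (M : ℝ), (∀ σ : ℝ, ∑' k : ℕ, physEnergy ε₀ W (n + k) σ ≤ M) →
        ∀ σ : ℝ, ∑' k : ℕ, physEnergy ε₀ W (n + b + k) σ ≤ (1 + ε₀) ^ (-(a * b)) * M := by
  obtain ⟨a, ha, εs, hεs, H⟩ := hK R hR
  refine ⟨a, ha, εs, hεs, fun ε₀ hε₀ hle b _hb α hα W hW hU n M hM σ => ?_⟩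
  exact blockRate_of_perShell hε₀ (fun n' M' hM' σ' => H ε₀ hε₀ hle α hα W hW hU n' M' hM' σ') b n M hM σ

/-- **BLOCK SPLIT GLUE (def-free).**  At spread `R`: the block INVISCID rate ratchet (admissible inviscid eternal solutions, exponent
`a₀ > 1`, block length `b₀(ε₀) ≥ 1`) and the block VISCOUS rate ratchet (covariant viscosity `ν̂ > 0`, exponent `a₁ > 1`, block length
`b₁(ε₀) ≥ 1`) give the block rate ratchet for EVERY covariant viscosity, with `a = min a₀ a₁` and `b = b₁·b₀` — the block form of the landed
glue ⟨25648⟩ `TailRateRatchetOfDissipationSplit` (case split on `IsEternalVisc.nonneg` / `isEternalVisc_zero_iff`; `block_iterate`).  The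
conclusion is verbatim the hypothesis of `RatchetStarvationBlock.noSurvivingEternalViscBdd_of_blockRateRatchet`.  Both hypotheses are NOT
supplied by the tree.  MODEL lattice only.  [cite: Tao2016AveragedNS, §4 Thm. 4.2 (statement shape), the viscous equation before it, §6.4] -/
theorem blockRateRatchet_of_split {R : ℝ}
    (hA : ∃ a : ℝ, 1 < a ∧ ∃ εs : ℝ, 0 < εs ∧ ∀ ε₀ : ℝ, 0 < ε₀ → ε₀ ≤ εs →
      ∃ b : ℕ, 1 ≤ b ∧
      ∀ α : Fin 4 → Fin 4 → Fin 4 → ℤ × ℤ × ℤ → ℝ, InTableClass R α →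
      ∀ W : ℤ → ℝ → Em 4, IsEternal ε₀ α W → UniformBound W →
      ∀ (n : ℤ) (M : ℝ), (∀ σ : ℝ, ∑' k : ℕ, physEnergy ε₀ W (n + k) σ ≤ M) →
        ∀ σ : ℝ, ∑' k : ℕ, physEnergy ε₀ W (n + b + k) σ ≤ (1 + ε₀) ^ (-(a * b)) * M)
    (hB : ∃ a : ℝ, 1 < a ∧ ∃ εs : ℝ, 0 < εs ∧ ∀ ε₀ : ℝ, 0 < ε₀ → ε₀ ≤ εs →
      ∃ b : ℕ, 1 ≤ b ∧
      ∀ α : Fin 4 → Fin 4 → Fin 4 → ℤ × ℤ × ℤ → ℝ, InTableClass R α →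
      ∀ (νh : ℝ) (W : ℤ → ℝ → Em 4), 0 < νh → IsEternalVisc ε₀ νh α W → UniformBound W →
      ∀ (n : ℤ) (M : ℝ), (∀ σ : ℝ, ∑' k : ℕ, physEnergy ε₀ W (n + k) σ ≤ M) →
        ∀ σ : ℝ, ∑' k : ℕ, physEnergy ε₀ W (n + b + k) σ ≤ (1 + ε₀) ^ (-(a * b)) * M) :
    ∃ a : ℝ, 1 < a ∧ ∃ εs : ℝ, 0 < εs ∧ ∀ ε₀ : ℝ, 0 < ε₀ → ε₀ ≤ εs →
      ∃ b : ℕ, 1 ≤ b ∧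
      ∀ α : Fin 4 → Fin 4 → Fin 4 → ℤ × ℤ × ℤ → ℝ, InTableClass R α →
      ∀ (νh : ℝ) (W : ℤ → ℝ → Em 4), IsEternalVisc ε₀ νh α W → UniformBound W →
      ∀ (n : ℤ) (M : ℝ), (∀ σ : ℝ, ∑' k : ℕ, physEnergy ε₀ W (n + k) σ ≤ M) →
        ∀ σ : ℝ, ∑' k : ℕ, physEnergy ε₀ W (n + b + k) σ ≤ (1 + ε₀) ^ (-(a * b)) * M := by
  obtain ⟨a₀, ha₀, εA, hεA, HA⟩ := hA
  obtain ⟨a₁, ha₁, εB, hεB, HB⟩ := hB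
  refine ⟨min a₀ a₁, lt_min ha₀ ha₁, min εA εB, lt_min hεA hεB, ?_⟩
  intro ε₀ hε₀ hle
  obtain ⟨b₀, hb₀, HA'⟩ := HA ε₀ hε₀ (hle.trans (min_le_left _ _))
  obtain ⟨b₁, hb₁, HB'⟩ := HB ε₀ hε₀ (hle.trans (min_le_right _ _))
  refine ⟨b₁ * b₀, Nat.one_le_iff_ne_zero.mpr (Nat.mul_ne_zero_iff.mpr ⟨by omega, by omega⟩), ?_⟩
  intro α hα νh W hW hU n M hM σ
  have hM0 : 0 ≤ M :=
    le_trans (tsum_nonneg fun k : ℕ => physEnergy_nonneg ε₀ W (n + (k : ℤ)) σ) (hM σ)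
  have h1 : (1 : ℝ) ≤ 1 + ε₀ := by linarith
  have hb₀' : (0 : ℝ) ≤ b₀ := by positivity
  have hb₁' : (0 : ℝ) ≤ b₁ := by positivity
  rcases hW.nonneg.eq_or_lt with h0 | hpos
  · -- `ν̂ = 0`: inviscid child, block `b₀` iterated `b₁` times
    rw [← h0] at hW
    have hW0 : IsEternal ε₀ α W := isEternalVisc_zero_iff.1 hW
    have hit := block_iterate hε₀ (HA' α hα W hW0 hU) n M hM b₁ σ
    refine hit.trans (mul_le_mul_of_nonneg_right (Real.rpow_le_rpow_of_exponent_le h1 ?_) hM0)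
    push_cast
    have : min a₀ a₁ ≤ a₀ := min_le_left _ _
    nlinarith [mul_nonneg hb₀' hb₁']
  · -- `ν̂ > 0`: viscous child, block `b₁` iterated `b₀` times
    have hit := block_iterate hε₀ (HB' α hα νh W hpos hW hU) n M hM b₀ σ
    have e : n + ((b₀ * b₁ : ℕ) : ℤ) = n + ((b₁ * b₀ : ℕ) : ℤ) := by rw [Nat.mul_comm]
    rw [e] at hit
    refine hit.trans (mul_le_mul_of_nonneg_right (Real.rpow_le_rpow_of_exponent_le h1 ?_) hM0)
    push_cast
    have : min a₀ a₁ ≤ a₁ := min_le_right _ _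
    nlinarith [mul_nonneg hb₀' hb₁']

/-- **⟨25647⟩ implies its block form for every block length** (dissipation-balanced slice, `ν̂ > 0`): the block viscous rate ratchet is a
weakening of the item `WakeRatchet.EternalViscousRate`, by name.  MODEL lattice only.
[cite: Tao2016AveragedNS, §4, the viscous equation before Thm. 4.2, §6.4; elementary] -/
theorem EternalViscousRate_blockForm
    (hK : Summit.NavierStokesRegularity.NavierStokesRegularity.Theses.WakeRatchet.EternalViscousRate)
    {R : ℝ} (hR : 1 ≤ R) :
    ∃ a : ℝ, 1 < a ∧ ∃ εs : ℝ, 0 < εs ∧ ∀ ε₀ : ℝ, 0 < ε₀ → ε₀ ≤ εs →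
      ∀ b : ℕ, 1 ≤ b →
      ∀ α : Fin 4 → Fin 4 → Fin 4 → ℤ × ℤ × ℤ → ℝ, InTableClass R α →
      ∀ (νh : ℝ) (W : ℤ → ℝ → Em 4), 0 < νh → IsEternalVisc ε₀ νh α W → UniformBound W →
      ∀ (n : ℤ) (M : ℝ), (∀ σ : ℝ, ∑' k : ℕ, physEnergy ε₀ W (n + k) σ ≤ M) →
        ∀ σ : ℝ, ∑' k : ℕ, physEnergy ε₀ W (n + b + k) σ ≤ (1 + ε₀) ^ (-(a * b)) * M := by
  obtain ⟨a, ha, εs, hεs, H⟩ := hK R hR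
  refine ⟨a, ha, εs, hεs, fun ε₀ hε₀ hle b _hb α hα νh W hν hW hU n M hM σ => ?_⟩
  exact blockRate_of_perShell hε₀ (fun n' M' hM' σ' => H ε₀ hε₀ hle α hα νh W hν hW hU n' M' hM' σ') b n M hM σ

/-- **⟨25584⟩ implies its block form for every block length** (any covariant viscosity `ν̂`): the block rate tail ratchet is a weakening of
the parent item `WakeRatchet.TailRateRatchet`, by name — and for `b`-dependent-on-`ε₀` block lengths a fortiori (instantiate `b`).  Its
conclusion at each `R` is the hypothesis of `RatchetStarvationBlock.noSurvivingEternalViscBdd_of_blockRateRatchet` (choose any `b ≥ 1`).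
MODEL lattice only.  [cite: Tao2016AveragedNS, §4 Thm. 4.2 (statement shape), §6.4; elementary] -/
theorem TailRateRatchet_blockForm
    (hK : Summit.NavierStokesRegularity.NavierStokesRegularity.Theses.WakeRatchet.TailRateRatchet)
    {R : ℝ} (hR : 1 ≤ R) :
    ∃ a : ℝ, 1 < a ∧ ∃ εs : ℝ, 0 < εs ∧ ∀ ε₀ : ℝ, 0 < ε₀ → ε₀ ≤ εs →
      ∀ b : ℕ, 1 ≤ b →
      ∀ α : Fin 4 → Fin 4 → Fin 4 → ℤ × ℤ × ℤ → ℝ, InTableClass R α →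
      ∀ (νh : ℝ) (W : ℤ → ℝ → Em 4), IsEternalVisc ε₀ νh α W → UniformBound W →
      ∀ (n : ℤ) (M : ℝ), (∀ σ : ℝ, ∑' k : ℕ, physEnergy ε₀ W (n + k) σ ≤ M) →
        ∀ σ : ℝ, ∑' k : ℕ, physEnergy ε₀ W (n + b + k) σ ≤ (1 + ε₀) ^ (-(a * b)) * M := by
  obtain ⟨a, ha, εs, hεs, H⟩ := hK R hR
  refine ⟨a, ha, εs, hεs, fun ε₀ hε₀ hle b _hb α hα νh W hW hU n M hM σ => ?_⟩
  exact blockRate_of_perShell hε₀ (fun n' M' hM' σ' => H ε₀ hε₀ hle α hα νh W hW hU n' M' hM' σ') b n M hM σ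

end WakeRatchetBlockRate

end Summit.NavierStokesRegularity.NavierStokesRegularity.Theorems

end
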